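import Summits.QuantumFields.YangMills.Theorems.BalabanUVNodesN26BetaContMerged
import Literature.MathematicalPhysics.QuantumFieldTheory.Balaban1983to89.Node00.BackgroundActionT
import Literature.MathematicalPhysics.QuantumFieldTheory.Balaban1983to89.Node00.SmallFieldChiFixedOfRecord
import Literature.MathematicalPhysics.QuantumFieldTheory.Balaban1983to89.Node00.Record8

/-!
# DAG node N26 — B4 «β-continuity» OVER A GENERIC TRANSPORT FAMILY AND χ-SLOT: the (D4) socket and the node's literal at the β built on def-B's
# transport-generic merged term family `Node00.mergedTermFamilyMatT F N T χ εbg` (`Node00/BackgroundActionT.lean`), with the two β's of the tree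
# as instances BY NAME — Stage 8's `betaOfRecord₈` (`T := TOfRecord`, `χ := chi7 θ`) and def-χ's (R1) `betaOfRecord₈χ` (`T := TOfRecord`,
# `χ := chiFixed7 θ.ν`) — and def-T's announced `betaOfRecord₈T T θ` ∕ `betaOfRecord₈c` ∕ `betaOfRecord₉c` (continuous-version transport) a substitution

Cell `pub-ymgap`, YM-PLAN Track A (HUMAN RULING D-0062), seat `pub-ymgap-dag-n26-a` (gen 4; -a = KNIT-BY-NAME); twelfth N26 companion.  STATUS OF RECORD:
N26 = binder B4 is DEPENDENT on (D4) and VACATED in the discharge form of record (closes WITH B3 = N25, NODE O); instance 0∕1.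

WHY THIS FILE.  RIDER OF RECORD №6 (β-VERSION; director-ym LINE №44∕№45 (2)): at Stages 8∕9 the β of record `betaOfRecord₈ θ` reads (a) the Stage-5
Radon–Nikodym transport `TrhoOfRecord` (= `Node00.TOfRecord`) — version-valued point values — and (b) the `RkOfRecord`-keyed χ `chi7 θ` — a step function of
the last coupling; no β-side binder is booked over it.  The repair of record re-points BOTH slots: def-χ's landed fixed-threshold `chiFixed7` ((R1),
`Node00/SmallFieldChiFixedOfRecord.lean`, p421459; flow-blind: `chiFixed7_flowBlind`) and def-T's continuous-version transport `TcOfRecord` (INTENT-4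
`Node00/ContinuousTransportOfRecord.lean`: `betaOfRecord₈T T θ := betaOfMerged (betaMerged F (mergedTermFamilyMatT F N T (chiFixed7 θ.ν) θ.εbg) θ.ρ8 θ.bV)
(beta0OfMerged … θ.v₀) θ.γ`, `betaOfRecord₈c := betaOfRecord₈T TcOfRecord`, `betaOfRecord₉c θ := betaOfRecord₈c θ.toStage8Params`).  Every one of these
β's is `betaOfMerged (betaMerged F ℰ ρ bV) (beta0OfMerged (betaMerged F ℰ ρ bV) v₀) γ` at the merged family `ℰ := mergedTermFamilyMatT F N T χ εbg` for SOME
transport family `T` and χ-slot `χ` — and the companions' (D4) socket (`BalabanUVNodesN26Merged.atSlopeCont_betaOfMerged`,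
`n26lit_betaOfMerged_of_localizedRep`) is GENERIC in `ℰ`.  So N26's by-name statement is written ONCE over `(T, χ)`:
* §1 `betaT F N T χ θ` is NOT defined (no `def` in a Theorems file): the β is written out as the displayed `betaOfMerged …` term; `betaContH_betaT_iff`
  (B4 on a box `γc ≤ θ.γ` IS per-`k` continuity of the merged β over `(T, χ)`), `n26lit_betaT_of_localizedRep` (N26's literal from the (D4) socket inputs
  for the `(T, χ)` merged family), `betaContH_betaT_of_localizedRep` (B4 on the box, no positivity clause).
* §2 THE TWO LANDED β's AS INSTANCES: `betaOfRecord₈_eq_betaT` (Stage 8's β IS the `(TOfRecord, chi7 θ)` instance — `Node00.mergedTermFamilyMat_eq_T`),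
  `betaOfRecord₈χ_eq_betaT` (def-χ's β IS the `(TOfRecord, chiFixed7 θ.ν)` instance), hence `n26lit_betaOfRecord₈χ_of_localizedRep` — N26 AT THE
  (R1)-REPAIRED β: the (C-pt) input no longer reads the R-step χ (hazard (a) gone by `chiFixed7_flowBlind`), the transport is still the RN version (hazard
  (b) stands) — and `betaContH_betaOfRecord₈χ_iff`.
* §3 for def-T's successor: `n26lit_betaT_chiFixed_of_localizedRep` — the `χ := chiFixed7 θ.ν` instance over ANY transport family `T`, i.e. VERBATIM the
  displayed body of `betaOfRecord₈T T θ`; at `T := TcOfRecord` it is N26 at `betaOfRecord₈c θ` ∕ `betaOfRecord₉c θ` by `rfl` the moment that module lands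
  (nothing of it is imported or restated here).

HONEST FRAMING.  Count-neutral bookkeeping by name for a VACATED binder; no definition, no estimate, 0 `sorry`.  `T`, `χ`, the one-loop kernels `P0`, the
leaf kernels `A1` are PARAMETERS; for Bałaban's objects every socket input (`hβ0 ∕ hP0 ∕ hrep ∕ hleaves ∕ (C-pt)`, the side conditions) is a located
hypothesis of NODE O — INSTANCE 0∕1; N26 NOT discharged; nothing of Bałaban's β asserted; which `(T, χ)` the record of record carries is NODE 00's decision
(def-T ∕ def-B ∕ plan g62 (c1)(c2)), not this file's.  One finite four-torus programme at fixed ε per run — NOT the continuum limit, NOT ℝ⁴, NOT infinite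
volume, NOT OS, NOT a mass gap, NOT Clay.
Sources (context): [I] = [Balaban1987RG1] Commun. Math. Phys. **109** (1987): (0.19) p. 255, (1.6)–(1.7) p. 261, (1.20)–(1.22) p. 264, (2.9) p. 259,
(5.10) p. 293; [II] = [Balaban1988RG2Cluster] Commun. Math. Phys. **116** (1988): Lemma 3 (2.38) p. 20.
-/

noncomputable section

open scoped Matrix.Norms.L2Operator

namespace Summit.QuantumFields.YangMills.Theorems.BalabanUVNodesN26TransportGeneric

open Literature.MathematicalPhysics.QuantumFieldTheory.Balaban1983to89
open Literature.MathematicalPhysics.QuantumFieldTheory.Balaban1983to89.FlowStep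
open Literature.MathematicalPhysics.QuantumFieldTheory.Balaban1983to89.T4Continuum (T4Family)
open Literature.MathematicalPhysics.QuantumFieldTheory.Balaban1983to89.Node00
open Literature.MathematicalPhysics.QuantumFieldTheory.Balaban1983to89.B13ScaleTransfer (Pt)
open Literature.MathematicalPhysics.QuantumFieldTheory.Balaban1983to89.Beta.RemainderChainLattice
open Literature.MathematicalPhysics.QuantumFieldTheory.Balaban1983to89.Beta.RemainderLimitTorus (LDom limKernel)
open Literature.MathematicalPhysics.QuantumFieldTheory.Balaban1983to89.Beta.RemainderDecay190
open Literature.MathematicalPhysics.QuantumFieldTheory.Balaban1983to89.Beta.RemainderLocalityHolo (PolLeavesTFac190H)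
open Summit.QuantumFields.YangMills.Theorems.BalabanUVNodesN26Record (betaContH_betaOfMerged_iff)
open Summit.QuantumFields.YangMills.Theorems.BalabanUVNodesN26Merged
  (betaContH_betaOfMerged_of_localizedRep n26lit_betaOfMerged_of_localizedRep)
open Filter Topology

variable (F : T4Family) (N : ℕ) [NeZero N]

/-! ## §1 N26 over a generic transport family `T` and χ-slot `χ` (Stage-8 chart, base histories and box) -/

section Generic

variable (T : Transport F N) (χ : (K : ℕ) → (ℕ → ℝ) → (k : ℕ) → Density (F.P K) k (Matrix.specialUnitaryGroup (Fin N) ℂ))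

/-- **WHAT B4 IS at the β over `(T, χ)`**: on a box `γc ≤ θ.γ`, `BetaContH γc` of
`betaOfMerged (betaMerged F (mergedTermFamilyMatT F N T χ θ.εbg) θ.ρ8 θ.bV) (beta0OfMerged … θ.v₀) θ.γ` IS per-`k` history-continuity of the MERGED β
`betaMerged F (mergedTermFamilyMatT F N T χ θ.εbg) θ.ρ8 θ.bV k` on `]0, γc]^{k+1}` (`BalabanUVNodesN26Record.betaContH_betaOfMerged_iff` BY NAME).
[cite: Balaban1987RG1, (1.20)-(1.22) p.264] -/
theorem betaContH_betaT_iff (θ : Stage8Params F N) {γc : ℝ} (hle : γc ≤ θ.γ) :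
    letI := θ.instVβ₁; letI := θ.instVβ₂; letI := θ.instιβ
    BetaContH γc (betaOfMerged (betaMerged F (mergedTermFamilyMatT F N T χ θ.εbg) θ.ρ8 θ.bV)
        (beta0OfMerged (betaMerged F (mergedTermFamilyMatT F N T χ θ.εbg) θ.ρ8 θ.bV) θ.v₀) θ.γ) ↔
      ∀ k, ContinuousOn (betaMerged F (mergedTermFamilyMatT F N T χ θ.εbg) θ.ρ8 θ.bV k) (Box γc k) := by
  letI := θ.instVβ₁; letI := θ.instVβ₂; letI := θ.instιβ
  exact betaContH_betaOfMerged_iff _ _ hle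

/-- **B4 ON THE BOX `γ₀ ≤ θ.γ` at the β over `(T, χ)`** from the (D4) socket inputs FOR THE `(T, χ)` MERGED FAMILY: one-loop kernels `P0` with
`hβ0 : beta0OfMerged … θ.v₀ k = Σ_z P0 k z · z₀z₁`, per-scale (5.10) `hP0`, leaf kernels `A1`, the split `hrep` of the merged limit kernel, the leaves
`hleaves`, the side conditions, (C-pt) (`BalabanUVNodesN26Merged.betaContH_betaOfMerged_of_localizedRep` BY NAME).  Instance 0∕1 for Bałaban's objects.
[cite: Balaban1987RG1, (1.7) p.261, (1.20)-(1.22) p.264 and (5.10) p.293; Balaban1988RG2Cluster, Lemma 3 (2.38) p.20] -/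
theorem betaContH_betaT_of_localizedRep (θ : Stage8Params F N) {γ₀ : ℝ} (hle : γ₀ ≤ θ.γ) {M : ℕ} [NeZero M]
    {c : B13.Consts} {ℓ α₂ : ℝ} {q : Consts190} (P0 : ℕ → Pt 4 → ℝ)
    (hβ0 : letI := θ.instVβ₁; letI := θ.instVβ₂; letI := θ.instιβ
      ∀ k, beta0OfMerged (betaMerged F (mergedTermFamilyMatT F N T χ θ.εbg) θ.ρ8 θ.bV) θ.v₀ k =
        B12Beta.secondMoment (fun _ _ => P0 k) 0 1)
    (hP0 : ∀ k, ∃ C δ₁ : ℝ, 0 < δ₁ ∧ B12Sec2to5.Decay510 (P0 k) C δ₁)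
    (A1 : (k : ℕ) → (Fin (k + 1) → ℝ) → LDom 4 → Pt 4 → ℝ)
    (hrep : letI := θ.instVβ₁; letI := θ.instVβ₂; letI := θ.instιβ
      ∀ k (p : Fin (k + 1) → ℝ), p ∈ Box γ₀ k → ∀ z : Pt 4,
        polLimit F (k + 1) (fun K => mergedTermFamilyMatT F N T χ θ.εbg k p K) θ.ρ8 θ.bV 0 1 z = P0 k z + limKernel (A1 k p) z)
    (hleaves : ∀ k (p : Fin (k + 1) → ℝ), p ∈ Box γ₀ k → PolLeavesTFac190H 4 M (A1 k p) c ℓ α₂ q)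
    (hC : CondsL 4 c ℓ) (h22 : c.R22gen ℓ) (hq : q.Valid c.δ₀) (hs : SignsL c α₂ q.B₃)
    (hcont : letI := θ.instVβ₁; letI := θ.instVβ₂; letI := θ.instιβ
      ∀ k (z : Pt 4), ContinuousOn (fun p : Fin (k + 1) → ℝ =>
        polLimit F (k + 1) (fun K => mergedTermFamilyMatT F N T χ θ.εbg k p K) θ.ρ8 θ.bV 0 1 z) (Box γ₀ k)) :
    letI := θ.instVβ₁; letI := θ.instVβ₂; letI := θ.instιβ
    BetaContH γ₀ (betaOfMerged (betaMerged F (mergedTermFamilyMatT F N T χ θ.εbg) θ.ρ8 θ.bV)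
      (beta0OfMerged (betaMerged F (mergedTermFamilyMatT F N T χ θ.εbg) θ.ρ8 θ.bV) θ.v₀) θ.γ) := by
  letI := θ.instVβ₁; letI := θ.instVβ₂; letI := θ.instιβ
  exact betaContH_betaOfMerged_of_localizedRep F _ θ.ρ8 θ.bV _ hle P0 hβ0 hP0 A1 hrep hleaves hC h22 hq hs hcont

/-- **N26's LITERAL at the β over `(T, χ)`** from the (D4) socket inputs on a box `0 < γ₀ ≤ θ.γ` (`γc := γ₀`;
`BalabanUVNodesN26Merged.n26lit_betaOfMerged_of_localizedRep` BY NAME).  Covers, by substitution: Stage 8's `betaOfRecord₈ θ` (`T := TOfRecord`,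
`χ := chi7 θ`; §2), def-χ's `betaOfRecord₈χ θ` (`T := TOfRecord`, `χ := chiFixed7 θ.ν`; §2), def-T's `betaOfRecord₈T T θ` ∕ `betaOfRecord₈c` ∕
`betaOfRecord₉c` (`χ := chiFixed7 θ.ν`; §3).  Instance 0∕1 for Bałaban's objects; N26 NOT discharged.
[cite: Balaban1987RG1, (1.7) p.261, (1.20)-(1.22) p.264 and (5.10) p.293; Balaban1988RG2Cluster, Lemma 3 (2.38) p.20] -/
theorem n26lit_betaT_of_localizedRep (θ : Stage8Params F N) {γ₀ : ℝ} (hγ₀ : 0 < γ₀) (hle : γ₀ ≤ θ.γ) {M : ℕ} [NeZero M]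
    {c : B13.Consts} {ℓ α₂ : ℝ} {q : Consts190} (P0 : ℕ → Pt 4 → ℝ)
    (hβ0 : letI := θ.instVβ₁; letI := θ.instVβ₂; letI := θ.instιβ
      ∀ k, beta0OfMerged (betaMerged F (mergedTermFamilyMatT F N T χ θ.εbg) θ.ρ8 θ.bV) θ.v₀ k =
        B12Beta.secondMoment (fun _ _ => P0 k) 0 1)
    (hP0 : ∀ k, ∃ C δ₁ : ℝ, 0 < δ₁ ∧ B12Sec2to5.Decay510 (P0 k) C δ₁)
    (A1 : (k : ℕ) → (Fin (k + 1) → ℝ) → LDom 4 → Pt 4 → ℝ)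
    (hrep : letI := θ.instVβ₁; letI := θ.instVβ₂; letI := θ.instιβ
      ∀ k (p : Fin (k + 1) → ℝ), p ∈ Box γ₀ k → ∀ z : Pt 4,
        polLimit F (k + 1) (fun K => mergedTermFamilyMatT F N T χ θ.εbg k p K) θ.ρ8 θ.bV 0 1 z = P0 k z + limKernel (A1 k p) z)
    (hleaves : ∀ k (p : Fin (k + 1) → ℝ), p ∈ Box γ₀ k → PolLeavesTFac190H 4 M (A1 k p) c ℓ α₂ q)
    (hC : CondsL 4 c ℓ) (h22 : c.R22gen ℓ) (hq : q.Valid c.δ₀) (hs : SignsL c α₂ q.B₃)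
    (hcont : letI := θ.instVβ₁; letI := θ.instVβ₂; letI := θ.instιβ
      ∀ k (z : Pt 4), ContinuousOn (fun p : Fin (k + 1) → ℝ =>
        polLimit F (k + 1) (fun K => mergedTermFamilyMatT F N T χ θ.εbg k p K) θ.ρ8 θ.bV 0 1 z) (Box γ₀ k)) :
    letI := θ.instVβ₁; letI := θ.instVβ₂; letI := θ.instιβ
    ∃ γc : ℝ, 0 < γc ∧ BetaContH γc (betaOfMerged (betaMerged F (mergedTermFamilyMatT F N T χ θ.εbg) θ.ρ8 θ.bV)
      (beta0OfMerged (betaMerged F (mergedTermFamilyMatT F N T χ θ.εbg) θ.ρ8 θ.bV) θ.v₀) θ.γ) := by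
  letI := θ.instVβ₁; letI := θ.instVβ₂; letI := θ.instιβ
  exact n26lit_betaOfMerged_of_localizedRep F _ θ.ρ8 θ.bV _ hγ₀ hle P0 hβ0 hP0 A1 hrep hleaves hC h22 hq hs hcont

end Generic

/-! ## §2 The two β's of the tree as `(T, χ)` instances: Stage 8's `betaOfRecord₈` and def-χ's (R1) `betaOfRecord₈χ` -/

section Instances

/-- **Stage 8's β of record IS the `(TOfRecord, chi7 θ)` instance** (`Node00.mergedTermFamilyMat_eq_T`: the Stage-5 RN transport as a family).
[cite: Balaban1987RG1, (0.19) p.255 and (1.20)-(1.22) p.264 (bookkeeping)] -/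
theorem betaOfRecord₈_eq_betaT (θ : Stage8Params F N) :
    betaOfRecord₈ F N θ =
      letI := θ.instVβ₁; letI := θ.instVβ₂; letI := θ.instιβ
      betaOfMerged (betaMerged F (mergedTermFamilyMatT F N (TOfRecord F N) (chi7 F N θ) θ.εbg) θ.ρ8 θ.bV)
        (beta0OfMerged (betaMerged F (mergedTermFamilyMatT F N (TOfRecord F N) (chi7 F N θ) θ.εbg) θ.ρ8 θ.bV) θ.v₀) θ.γ := by
  unfold betaOfRecord₈
  rw [mergedTermFamilyMat_eq_T]

/-- **def-χ's (R1) β `betaOfRecord₈χ θ` IS the `(TOfRecord, chiFixed7 θ.ν)` instance** (same bridge).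
[cite: Balaban1987RG1, (2.9) p.259 and (1.20)-(1.22) p.264 (bookkeeping)] -/
theorem betaOfRecord₈χ_eq_betaT (θ : Stage8Params F N) :
    betaOfRecord₈χ F N θ =
      letI := θ.instVβ₁; letI := θ.instVβ₂; letI := θ.instιβ
      betaOfMerged (betaMerged F (mergedTermFamilyMatT F N (TOfRecord F N) (chiFixed7 F N θ.ν) θ.εbg) θ.ρ8 θ.bV)
        (beta0OfMerged (betaMerged F (mergedTermFamilyMatT F N (TOfRecord F N) (chiFixed7 F N θ.ν) θ.εbg) θ.ρ8 θ.bV) θ.v₀) θ.γ := by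
  unfold betaOfRecord₈χ
  rw [mergedTermFamilyMat_eq_T]

/-- **WHAT B4 IS AT def-χ's (R1) β**: on a box `γc ≤ θ.γ`, `BetaContH γc (betaOfRecord₈χ F N θ)` IS per-`k` history-continuity of the merged β over
`(TOfRecord, chiFixed7 θ.ν)` — a χ that is FLOW-BLIND (`Node00.chiFixed7_flowBlind`), so the R-STEP hazard of RIDER №6 (a) is absent from this reading;
the transport is still the Stage-5 RN version (hazard (b) stands; def-T's `TcOfRecord` repairs it). [cite: Balaban1987RG1, (2.9) p.259 and (1.20)-(1.22) p.264] -/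
theorem betaContH_betaOfRecord₈χ_iff (θ : Stage8Params F N) {γc : ℝ} (hle : γc ≤ θ.γ) :
    BetaContH γc (betaOfRecord₈χ F N θ) ↔
      letI := θ.instVβ₁; letI := θ.instVβ₂; letI := θ.instιβ
      ∀ k, ContinuousOn (betaMerged F (mergedTermFamilyMatT F N (TOfRecord F N) (chiFixed7 F N θ.ν) θ.εbg) θ.ρ8 θ.bV k) (Box γc k) := by
  rw [betaOfRecord₈χ_eq_betaT]
  exact betaContH_betaT_iff F N (TOfRecord F N) (chiFixed7 F N θ.ν) θ hle

/-- **N26 AT def-χ's (R1) β `betaOfRecord₈χ θ`** from the (D4) socket inputs for the `(TOfRecord, chiFixed7 θ.ν)` merged family on a box `0 < γ₀ ≤ θ.γ`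
(§1 at that instance, through `betaOfRecord₈χ_eq_betaT`).  The (C-pt) input here is asked of a family whose χ-slot is flow-blind (no step function of the
last coupling enters through χ); instance 0∕1 for Bałaban's objects; N26 NOT discharged; `betaOfRecord₈χ` is OFFERED by def-χ, bound by no record yet.
[cite: Balaban1987RG1, (1.7) p.261, (2.9) p.259, (1.20)-(1.22) p.264 and (5.10) p.293; Balaban1988RG2Cluster, Lemma 3 (2.38) p.20] -/
theorem n26lit_betaOfRecord₈χ_of_localizedRep (θ : Stage8Params F N) {γ₀ : ℝ} (hγ₀ : 0 < γ₀) (hle : γ₀ ≤ θ.γ) {M : ℕ} [NeZero M]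
    {c : B13.Consts} {ℓ α₂ : ℝ} {q : Consts190} (P0 : ℕ → Pt 4 → ℝ)
    (hβ0 : letI := θ.instVβ₁; letI := θ.instVβ₂; letI := θ.instιβ
      ∀ k, beta0OfMerged (betaMerged F (mergedTermFamilyMatT F N (TOfRecord F N) (chiFixed7 F N θ.ν) θ.εbg) θ.ρ8 θ.bV) θ.v₀ k =
        B12Beta.secondMoment (fun _ _ => P0 k) 0 1)
    (hP0 : ∀ k, ∃ C δ₁ : ℝ, 0 < δ₁ ∧ B12Sec2to5.Decay510 (P0 k) C δ₁)
    (A1 : (k : ℕ) → (Fin (k + 1) → ℝ) → LDom 4 → Pt 4 → ℝ)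
    (hrep : letI := θ.instVβ₁; letI := θ.instVβ₂; letI := θ.instιβ
      ∀ k (p : Fin (k + 1) → ℝ), p ∈ Box γ₀ k → ∀ z : Pt 4,
        polLimit F (k + 1) (fun K => mergedTermFamilyMatT F N (TOfRecord F N) (chiFixed7 F N θ.ν) θ.εbg k p K) θ.ρ8 θ.bV 0 1 z =
          P0 k z + limKernel (A1 k p) z)
    (hleaves : ∀ k (p : Fin (k + 1) → ℝ), p ∈ Box γ₀ k → PolLeavesTFac190H 4 M (A1 k p) c ℓ α₂ q)
    (hC : CondsL 4 c ℓ) (h22 : c.R22gen ℓ) (hq : q.Valid c.δ₀) (hs : SignsL c α₂ q.B₃)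
    (hcont : letI := θ.instVβ₁; letI := θ.instVβ₂; letI := θ.instιβ
      ∀ k (z : Pt 4), ContinuousOn (fun p : Fin (k + 1) → ℝ =>
        polLimit F (k + 1) (fun K => mergedTermFamilyMatT F N (TOfRecord F N) (chiFixed7 F N θ.ν) θ.εbg k p K) θ.ρ8 θ.bV 0 1 z)
        (Box γ₀ k)) :
    ∃ γc : ℝ, 0 < γc ∧ BetaContH γc (betaOfRecord₈χ F N θ) := by
  rw [betaOfRecord₈χ_eq_betaT]
  exact n26lit_betaT_of_localizedRep F N (TOfRecord F N) (chiFixed7 F N θ.ν) θ hγ₀ hle P0 hβ0 hP0 A1 hrep hleaves hC h22 hq hs hcont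

end Instances

/-! ## §3 The `χ := chiFixed7 θ.ν` instance over ANY transport family — the displayed body of def-T's `betaOfRecord₈T T θ` -/

section ForRecord10

variable (T : Transport F N)

/-- **N26 AT THE β OVER `(T, chiFixed7 θ.ν)` FOR ANY TRANSPORT FAMILY `T`** — verbatim the displayed body of def-T's announced `betaOfRecord₈T F N T θ`
(INTENT-4 `Node00/ContinuousTransportOfRecord.lean`; at `T := TcOfRecord` it is `betaOfRecord₈c θ`, and `betaOfRecord₉c θ = betaOfRecord₈c θ.toStage8Params`),
from the (D4) socket inputs for that merged family on a box `0 < γ₀ ≤ θ.γ`.  When that module lands, N26 at `betaOfRecord₈c ∕ ₉c` is this theorem at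
`T := TcOfRecord` by `rfl`; nothing of it is imported or restated here.  At a continuous-version transport BOTH hazards of RIDER №6 are absent from the
reading (point values determined, χ flow-blind) PROVIDED the record's predicate CONJOINS the located proviso `HasContTransportAlong θ` (dag-ref-D's
conditions (C1)–(C3) on INTENT-4, pub-ymgap INBOX l.11076: off that proviso `contVersion` is junk `0` and a β-side ∀-form would be vacuous by junk) — so a
β-side binder over this β is bookable only at such a record; here `T` is a parameter and nothing is booked; instance 0∕1, N26 NOT discharged.
[cite: Balaban1987RG1, (0.19) p.255, (1.7) p.261, (2.9) p.259, (1.20)-(1.22) p.264 and (5.10) p.293; Balaban1988RG2Cluster, Lemma 3 (2.38) p.20] -/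
theorem n26lit_betaT_chiFixed_of_localizedRep (θ : Stage8Params F N) {γ₀ : ℝ} (hγ₀ : 0 < γ₀) (hle : γ₀ ≤ θ.γ) {M : ℕ} [NeZero M]
    {c : B13.Consts} {ℓ α₂ : ℝ} {q : Consts190} (P0 : ℕ → Pt 4 → ℝ)
    (hβ0 : letI := θ.instVβ₁; letI := θ.instVβ₂; letI := θ.instιβ
      ∀ k, beta0OfMerged (betaMerged F (mergedTermFamilyMatT F N T (chiFixed7 F N θ.ν) θ.εbg) θ.ρ8 θ.bV) θ.v₀ k =
        B12Beta.secondMoment (fun _ _ => P0 k) 0 1)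
    (hP0 : ∀ k, ∃ C δ₁ : ℝ, 0 < δ₁ ∧ B12Sec2to5.Decay510 (P0 k) C δ₁)
    (A1 : (k : ℕ) → (Fin (k + 1) → ℝ) → LDom 4 → Pt 4 → ℝ)
    (hrep : letI := θ.instVβ₁; letI := θ.instVβ₂; letI := θ.instιβ
      ∀ k (p : Fin (k + 1) → ℝ), p ∈ Box γ₀ k → ∀ z : Pt 4,
        polLimit F (k + 1) (fun K => mergedTermFamilyMatT F N T (chiFixed7 F N θ.ν) θ.εbg k p K) θ.ρ8 θ.bV 0 1 z =
          P0 k z + limKernel (A1 k p) z)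
    (hleaves : ∀ k (p : Fin (k + 1) → ℝ), p ∈ Box γ₀ k → PolLeavesTFac190H 4 M (A1 k p) c ℓ α₂ q)
    (hC : CondsL 4 c ℓ) (h22 : c.R22gen ℓ) (hq : q.Valid c.δ₀) (hs : SignsL c α₂ q.B₃)
    (hcont : letI := θ.instVβ₁; letI := θ.instVβ₂; letI := θ.instιβ
      ∀ k (z : Pt 4), ContinuousOn (fun p : Fin (k + 1) → ℝ =>
        polLimit F (k + 1) (fun K => mergedTermFamilyMatT F N T (chiFixed7 F N θ.ν) θ.εbg k p K) θ.ρ8 θ.bV 0 1 z) (Box γ₀ k)) :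
    letI := θ.instVβ₁; letI := θ.instVβ₂; letI := θ.instιβ
    ∃ γc : ℝ, 0 < γc ∧ BetaContH γc (betaOfMerged (betaMerged F (mergedTermFamilyMatT F N T (chiFixed7 F N θ.ν) θ.εbg) θ.ρ8 θ.bV)
      (beta0OfMerged (betaMerged F (mergedTermFamilyMatT F N T (chiFixed7 F N θ.ν) θ.εbg) θ.ρ8 θ.bV) θ.v₀) θ.γ) :=
  n26lit_betaT_of_localizedRep F N T (chiFixed7 F N θ.ν) θ hγ₀ hle P0 hβ0 hP0 A1 hrep hleaves hC h22 hq hs hcont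

end ForRecord10

end Summit.QuantumFields.YangMills.Theorems.BalabanUVNodesN26TransportGeneric

end
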